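import Literature.NumberTheory.GaloisRepresentations.WeakAbelianDirectSummandIdelicProofs
import Literature.NumberTheory.GaloisRepresentations.PadicCharacterLocallyAlgebraicProofs
import Mathlib.NumberTheory.Padics.HeightOneSpectrum
import Mathlib.RingTheory.Localization.Integral
import HarnessLib

/-!
# Weak abelian direct summands over `ℚ`: a power of the character is locally algebraic (proved)

Topic `NumberTheory/GaloisRepresentations`; namespace
`Literature.NumberTheory.GaloisRepresentations`.  A *proofs* file (theorems only; no definition,
no named fact, no instance), sibling of `WeakAbelianDirectSummand.lean` (Böckle–Hui 2025, Thm. 1.1;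
named fact `exists_heckeCharacter_of_weaklyDivides`).

**Theorem** (`WeaklyDivides.exists_pow_idelic_eq_pow_rat`).  Let `v` be a finite place of `ℚ`,
`ℓ = p_v` its prime, `ρ : Γ_ℚ → GL_n(ℚ̄_ℓ)` an `E`-rational `ℓ`-adic representation and
`ψ : Γ_ℚ → GL_1(ℚ̄_ℓ)` a character weakly dividing `ρ`.  Let `Ψ = ψ ∘ Art_ℚ : 𝕀_ℚ →ₜ* ℚ̄_ℓˣ` be
its idele class character (trivial on `ℚˣ`; at almost all `w`: `ψ` unramified, `Ψ(⟨ℤ_wˣ⟩) = 1`,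
`ψ(Frob_w) = Ψ(⟨ϖ⟩_w)`).  Then **there are `b ≥ 1` and `a ∈ ℤ` with `Ψ(⟨u⟩_v)^b = u^a` for every
`u ∈ ℤ_ℓˣ = 𝒪_vˣ`**, i.e. `ψ^b ∘ Art_ℚ ∘ i_ℓ (u) = u^a`: *`ψ^b` is locally algebraic* (BH §2.3, with
`r_ℓ(x) = x^{-a}`).  This is the first step of the printed proof of BH Thm. 1.1 (§2.7: "there
exists `N ∈ ℕ` such that `ψ_ℓ^N` is locally algebraic by `E`-rationality of `ρ_ℓ` and Theorem 2.2"),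
i.e. BH Thm. 2.2 for `ψ`, in the case `K = ℚ` — where the `ℓ`-adic transcendence theorem is
Serre's (Ch. III §3, Lang's six exponentials method), PROVED in the tree
(`exists_pow_eq_pow_of_isAlgebraic`, `PadicCharacterLocallyAlgebraicProofs.lean`).

Proof: `WeaklyDivides.exists_idelicCharacter_isAlgebraic` (sibling `…IdelicProofs.lean`) supplies
`Ψ`, a finite `S ∋ v` and the algebraicity of `Ψ(⟨q⟩_v)` for the primes `q` outside
`{p_w : w ∈ S}` (Serre's product formula computation); transporting along Mathlib's
`ℤ_v ≃ ℤ_ℓ` (`adicCompletionIntegers.padicIntEquiv`) and into the complete field `ℂ_ℓ`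
(`PadicComplex`), the continuous character `g(u) = Ψ(⟨u⟩_v)` of `ℤ_ℓˣ` has algebraic values at
these primes, and `exists_pow_eq_pow_of_isAlgebraic` gives `g^b = u^a`.

## References

* G. Böckle, C.-Y. Hui, Math. Ann. 393 (2025), §2.3, Thm. 2.2, §2.7. [BockleHui2025]
* J.-P. Serre, *Abelian ℓ-adic representations and elliptic curves* (1968), Ch. III §1.1
  (locally algebraic), §3 (the theorem for `K = ℚ`). [SerreAbelianLadic1968]
-/

noncomputable section

open scoped NumberField Polynomial Topology
open NumberField IsDedekindDomain IsDedekindDomain.HeightOneSpectrum Field Polynomial Filter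
open Rat.HeightOneSpectrum

namespace Literature.NumberTheory.GaloisRepresentations

namespace FramedGaloisRep

attribute [local instance] Rat.fact_prime_natGenerator

/-- Algebraicity over `ℤ` is preserved by ring homomorphisms, for any `ℤ`-algebra structures
(there is only one, but instance paths differ). [folklore] -/
theorem isAlgebraic_int_map {A B : Type*} [Ring A] [Ring B] {instA : Algebra ℤ A}
    {instB : Algebra ℤ B} (f : A →+* B) {x : A} (h : IsAlgebraic ℤ x) : IsAlgebraic ℤ (f x) := by
  obtain ⟨P, hP0, hP⟩ := h
  refine ⟨P, hP0, ?_⟩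
  rw [Polynomial.aeval_def, ← RingHom.ext_int (f.comp (algebraMap ℤ A)) (algebraMap ℤ B),
    ← Polynomial.hom_eval₂, ← Polynomial.aeval_def, hP, map_zero]

/-- **Böckle–Hui Thm. 2.2 for a weak abelian direct summand over `ℚ`: a power of `ψ` is locally
algebraic.**  See the module docstring. [cite: BockleHui2025, §2.3, Thm. 2.2 and §2.7 (first step of the proof of Thm. 1.1)]
[cite: SerreAbelianLadic1968, Ch. III §3 (Theorem, `K = ℚ`)] -/
theorem WeaklyDivides.exists_pow_idelic_eq_pow_rat (v : HeightOneSpectrum (𝓞 ℚ))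
    {E : Type*} [Field E] [NumberField E] (e : E →+* PadicAlgCl (natGenerator v)) {n : ℕ}
    {ρ : FramedGaloisRep ℚ (PadicAlgCl (natGenerator v)) n} (hρ : ρ.IsRationalOver e)
    {ψ : FramedGaloisRep ℚ (PadicAlgCl (natGenerator v)) 1} (h : ψ.WeaklyDivides ρ) :
    ∃ Ψ : ideleGroup ℚ →ₜ* (PadicAlgCl (natGenerator v))ˣ, (∀ x ∈ principalIdeles ℚ, Ψ x = 1) ∧
      (∀ᶠ w : HeightOneSpectrum (𝓞 ℚ) in cofinite, ψ.IsUnramifiedAt w ∧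
        (∀ u : (w.adicCompletionIntegers ℚ)ˣ,
          Ψ (localUnits w (Units.map ((w.adicCompletionIntegers ℚ).subtype : _ →* _) u)) = 1) ∧
        ∀ ϖ : (w.adicCompletion ℚ)ˣ,
          Valued.v (ϖ : w.adicCompletion ℚ) = WithZero.exp (-1 : ℤ) →
            ψ.HasFrobCharpolyAt w (X - C ((Ψ (localUnits w ϖ) :
              (PadicAlgCl (natGenerator v))ˣ) : PadicAlgCl (natGenerator v)))) ∧
      ∃ b : ℕ, 0 < b ∧ ∃ a : ℤ, ∀ u : (v.adicCompletionIntegers ℚ)ˣ,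
        ((Ψ (localUnits v (Units.map ((v.adicCompletionIntegers ℚ).subtype : _ →* _) u)) :
            (PadicAlgCl (natGenerator v))ˣ) : PadicAlgCl (natGenerator v)) ^ b =
          (algebraMap ℚ_[natGenerator v] (PadicAlgCl (natGenerator v))
            (Rat.toPadic v ((u : v.adicCompletionIntegers ℚ) : v.adicCompletion ℚ))) ^ a := by
  classical
  set p : ℕ := natGenerator v with hp_def
  have hp : p.Prime := prime_natGenerator v
  obtain ⟨Ψ, hK, S, hSℓ, hi, hii, hiii⟩ :=
    WeaklyDivides.exists_idelicCharacter_isAlgebraic (K := ℚ) (ℓ := p) e hρ h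
  refine ⟨Ψ, hK, ?_, ?_⟩
  · rw [Filter.eventually_cofinite]
    exact S.finite_toSet.subset fun w hw => by
      by_contra hwS
      exact hw (hi w hwS)
  -- the place `v` lies in `S`
  have hpv : (p : 𝓞 ℚ) ∈ v.asIdeal := (Rat.natCast_mem_asIdeal_iff v).mpr dvd_rfl
  have hvS : v ∈ S := hSℓ v hpv
  -- `S.filter (p ∈ ·) = {v}`
  have hfilter : S.filter (fun w => (p : 𝓞 ℚ) ∈ w.asIdeal) = {v} := by
    ext w
    rw [Finset.mem_filter, Finset.mem_singleton]
    constructor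
    · rintro ⟨-, hw⟩
      have hdvd : natGenerator w ∣ p := (Rat.natCast_mem_asIdeal_iff w).mp hw
      have heq : natGenerator w = p :=
        (Nat.prime_dvd_prime_iff_eq (prime_natGenerator w) hp).mp hdvd
      exact Rat.natGenerator_injective heq
    · rintro rfl
      exact ⟨hvS, hpv⟩
  -- the transport `ℤ_ℓˣ → 𝒪_vˣ` and the character `g` on `ℤ_ℓˣ` with values in `ℂ_ℓ`
  let eZ : v.adicCompletionIntegers ℚ ≃+* ℤ_[p] :=
    (adicCompletionIntegers.padicIntEquiv v).toAlgEquiv.toRingEquiv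
  have heZc : Continuous eZ.symm := (adicCompletionIntegers.padicIntEquiv v).symm.continuous
  have heZval : ∀ x : v.adicCompletionIntegers ℚ, ((eZ x : ℤ_[p]) : ℚ_[p]) =
      Rat.toPadic v (x : v.adicCompletion ℚ) := fun x => rfl
  set θ : ℤ_[p]ˣ →* (v.adicCompletionIntegers ℚ)ˣ := Units.map eZ.symm.toMonoidHom with hθ_def
  have hθc : Continuous θ := Continuous.units_map _ heZc
  have hθval : ∀ u : ℤ_[p]ˣ, ((θ u : (v.adicCompletionIntegers ℚ)ˣ) : v.adicCompletionIntegers ℚ) =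
      eZ.symm (u : ℤ_[p]) := fun u => rfl
  set ι : PadicAlgCl p →+* ℂ_[p] := algebraMap (PadicAlgCl p) ℂ_[p] with hι_def
  have hιc : Continuous ι := UniformSpace.Completion.continuous_coe (PadicAlgCl p)
  set φ : (v.adicCompletionIntegers ℚ)ˣ →* (PadicAlgCl p)ˣ :=
    Ψ.toMonoidHom.comp ((localUnits v).comp
      (Units.map ((v.adicCompletionIntegers ℚ).subtype : _ →* _))) with hφ_def
  have hφ : ∀ u, φ u = Ψ (localUnits v (Units.map ((v.adicCompletionIntegers ℚ).subtype :
      _ →* _) u)) := fun u => rfl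
  have hφc : Continuous φ := Ψ.continuous.comp (IdelicCharacter.continuous_localUnits_unitsMap v)
  set g₀ : ℤ_[p]ˣ →* ℂ_[p]ˣ := (Units.map (ι : PadicAlgCl p →* ℂ_[p])).comp (φ.comp θ)
    with hg₀_def
  have hg₀ : ∀ u, ((g₀ u : ℂ_[p]ˣ) : ℂ_[p]) = ι ((φ (θ u) : (PadicAlgCl p)ˣ) : PadicAlgCl p) :=
    fun u => rfl
  have hg₀c : Continuous g₀ := (Continuous.units_map _ hιc).comp (hφc.comp hθc)
  set g : ℤ_[p]ˣ →ₜ* ℂ_[p]ˣ := ⟨g₀, hg₀c⟩ with hg_def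
  have hg : ∀ u, ((g u : ℂ_[p]ˣ) : ℂ_[p]) = ι ((φ (θ u) : (PadicAlgCl p)ˣ) : PadicAlgCl p) :=
    fun u => rfl
  -- the exceptional primes
  set S' : Set ℕ := (fun w : HeightOneSpectrum (𝓞 ℚ) => natGenerator w) '' (S : Set _)
    with hS'_def
  have hS'fin : S'.Finite := S.finite_toSet.image _
  -- algebraic values at the good primes, and Serre's theorem for `K = ℚ`
  obtain ⟨b, hb, a, hba⟩ := exists_pow_eq_pow_of_isAlgebraic g hS'fin (by
    intro q hq hqS u hu
    have hq0 : (q : ℚ) ≠ 0 := Nat.cast_ne_zero.mpr hq.ne_zero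
    set k : ℚˣ := Units.mk0 (q : ℚ) hq0 with hk_def
    -- `u = q` in `ℤ_ℓ`
    have hu' : (u : ℤ_[p]) = (q : ℤ_[p]) := by
      apply Subtype.ext
      rw [PadicInt.coe_natCast]
      exact hu
    -- `θ u` is the global unit `q`
    have hθu : Units.map ((v.adicCompletionIntegers ℚ).subtype : _ →* _) (θ u) =
        globalToLocalUnits v k := by
      apply Units.ext
      rw [Units.coe_map, val_globalToLocalUnits, hk_def, Units.val_mk0, map_natCast]
      change (((θ u : (v.adicCompletionIntegers ℚ)ˣ) : v.adicCompletionIntegers ℚ) :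
        v.adicCompletion ℚ) = _
      rw [hθval u, hu', map_natCast]
      rfl
    -- `k = q` is a unit at the places of `S` other than `v`
    have hkS : ∀ w ∈ S, (p : 𝓞 ℚ) ∉ w.asIdeal → w.valuation ℚ (k : ℚ) = 1 := by
      intro w hw _
      have hne : natGenerator w ≠ q := fun heq => hqS ⟨w, hw, heq⟩
      have hndvd : ¬ ((natGenerator w : ℤ) ∣ (q : ℤ)) := fun hd => by
        have hd' : natGenerator w ∣ q := by exact_mod_cast hd
        exact hne ((Nat.prime_dvd_prime_iff_eq (prime_natGenerator w) hq).mp hd')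
      have := Rat.valuation_intCast_eq_one w hndvd
      rw [hk_def, Units.val_mk0]
      exact_mod_cast this
    have halgk := hiii k hkS
    rw [hfilter, Finset.prod_singleton] at halgk
    rw [hg, hφ, hθu]
    exact isAlgebraic_int_map ι ((IsFractionRing.isAlgebraic_iff ℤ ℚ (PadicAlgCl p)).mpr halgk))
  refine ⟨b, hb, a, fun u => ?_⟩
  set u' : ℤ_[p]ˣ := Units.map eZ.toMonoidHom u with hu'_def
  have hθu' : θ u' = u := by
    apply Units.ext
    rw [hθval u', hu'_def, Units.coe_map]
    exact eZ.symm_apply_apply _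
  have hu'val : ((u' : ℤ_[p]) : ℚ_[p]) =
      Rat.toPadic v ((u : v.adicCompletionIntegers ℚ) : v.adicCompletion ℚ) := heZval _
  have h1 := hba u'
  rw [hg, hθu', hφ, ← map_pow, hu'val,
    IsScalarTower.algebraMap_apply ℚ_[p] (PadicAlgCl p) ℂ_[p], ← hι_def, ← map_zpow₀] at h1
  exact ι.injective h1

end FramedGaloisRep

end Literature.NumberTheory.GaloisRepresentations

end
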